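import Literature.Analysis.FluidPDE.TorusLinearisedNSH1Balance
import Literature.Analysis.FluidPDE.TorusLinearisedNSH3Balance
import HarnessLib

/-!
# `V → H³` smoothing of the linearised Navier–Stokes equation along a smooth field on `T³`

Analysis/FluidPDE proof file (theorems only; no definitions, no named facts), sequel of
`TorusLinearisedNSH3Balance.lean` (the `H³` balance of the first variation equation and its flux
bound on `T³`), `TorusLinearisedNSH2Balance.lean` / `TorusLinearisedNSH2Smoothing.lean` (the `H²`
balance, its flux bound, the `V → D(A)` smoothing) and `TorusLinearisedNSH1Balance.lean` (the `H¹`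
balance and the exponential `H¹` bound), one Sobolev level above the `V → D(A)` estimate. For a
jointly smooth solution `(w, q)` of the linearised Navier–Stokes equation
`∂ₜw + (u·∇)w + (w·∇)u = νΔw − ∇q`, `div w = 0`, `∫ w = 0`, along a jointly smooth divergence-free
field `u` on `[a, a + τ] × T^d`, `card d = 3`, with `‖u‖ ≤ M`, `‖∂ᵢu‖ ≤ L`, `‖Δu(t)‖₂² ≤ Y₁` and
`‖∇Δu(t)‖₂² ≤ Z₁`, the theorem `Torus.linearisedNS_gradNormSq_laplacian_le_mul` is the PARABOLIC
SMOOTHING ESTIMATE of the derivative cocycle from `V` to `H³ = D(A^{3/2})`: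

`‖∇Δw(a + τ)‖₂² ≤ C(d, ν, M, L, Y₁, Z₁, τ) (∫ ‖w(a)‖² + ‖∇w(a)‖₂²)`,

i.e. the solution operator `S'(t, u₀)` of the first variation equation maps `V` boundedly into
`D(A^{3/2})` for `t > a` (Constantin–Foias 1988, Ch. 14, the discussion after (14.4), two levels
above "`S'(t, u₀)` maps `H` into `V` boundedly", by the a priori estimates of Prop. 13.2 / Thm 10.6;
Temam 1997, Ch. VI §3.1), with a constant depending on `u` only through `M`, `L`, `Y₁`, `Z₁` and on
the time lapse. This is what makes the linearised vector field `νΔw − P((u·∇)w + (w·∇)u)` land in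
`V` at positive times (time regularity of the derivative cocycle, block N of the smooth-model
construction for NS phases).

Proof (no time integrals), `E = ∫ ‖w‖²`, `G = ‖∇w‖₂²`, `Y = ‖Δw‖₂²`, `Z = ‖∇Δw‖₂²`: the three balances
with their flux bounds, each keeping half of its dissipation,
`(½G)' ≤ −(ν/2)Y + ν⁻¹(dM² G + (dL)² E)` (`Torus.linearisedNS_half_gradNormSq_flux_le` at `ν/2`),
`(½Y)' ≤ −(ν/2)Z + K₁(G + Y)` (`Torus.linearisedNS_laplacian_flux_le` at `ν/2`),
`(½Z)' ≤ K₂(G + Y + Z)` (`Torus.linearisedNS_gradNormSq_laplacian_flux_le`); the doubly weighted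
combination `Φ(s) = (s − a)²·½Z + κ₁(s − a)·½Y + κ₂·½G` with `κ₁ = 2(1 + τK₂)/ν`,
`κ₂ = 2(τ²K₂ + κ₁/2 + κ₁τK₁)/ν` has `Φ' ≤ β(E + G)` (the `Z`- and `Y`-terms produced by the weights
are absorbed by the retained dissipations), `(E + G)(s) ≤ (E + G)(a) e^{K'τ}`
(`Torus.linearisedNS_h1_le_mul_exp`), and the fencing lemma
(`image_le_of_deriv_right_le_deriv_boundary`) gives `τ²·½Z(a + τ) ≤ Φ(a + τ) ≤ κ₂·½G(a) + βτe^{K'τ}(E + G)(a)`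
— no `H²` or `H³` datum is needed. The real-variable core (three coupled levels, doubly weighted
combination, fencing) is isolated as `Torus.sq_mul_le_of_three_level_balance`. Deliberately NOT here:
backward estimates, `H⁴`, existence of linearised solutions, time derivatives.

## Mathlib / tree search

Tree (reused): `Torus.linearisedNS_hasDerivWithinAt_half_gradNormSq_laplacian`,
`Torus.linearisedNS_gradNormSq_laplacian_flux_le` (`TorusLinearisedNSH3Balance`),
`Torus.linearisedNS_hasDerivWithinAt_half_integral_norm_laplacian_sq`, `Torus.linearisedNS_laplacian_flux_le`
(`TorusLinearisedNSH2Balance`), `Torus.linearisedNS_hasDerivWithinAt_half_gradNormSq`,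
`Torus.linearisedNS_half_gradNormSq_flux_le`, `Torus.linearisedNS_h1_le_mul_exp`
(`TorusLinearisedNSH1Balance`); the pattern is `Torus.linearisedNS_integral_norm_laplacian_sq_le_mul`
(`TorusLinearisedNSH2Smoothing`). Mathlib: `image_le_of_deriv_right_le_deriv_boundary`. Searched
`gradNormSq (Torus.laplacian (w`, `linearisedNS.*H3`, `V → D(A^{3/2})` for the linearised equation:
nothing (the module docstring of `TorusLinearisedNSH2Smoothing` lists `D(A) → D(A^{3/2})` as not treated).

## References

* P. Constantin, C. Foias, *Navier–Stokes Equations*, Univ. Chicago Press 1988, Ch. 13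
  Prop. 13.2, Ch. 14, (14.2)–(14.4), and Thm 10.6. [ConstantinFoiasNSE1988]
* R. Temam, *Infinite-Dimensional Dynamical Systems in Mechanics and Physics*, 2nd ed.,
  Springer 1997, Ch. VI §3.1. [Temam1997]
-/

noncomputable section

open MeasureTheory Set Function Filter
open scoped ContDiff InnerProductSpace RealInnerProductSpace Topology

namespace Literature.Analysis.FluidPDE

open Literature.Analysis.FunctionSpaces

variable {d : Type*} [Fintype d] [DecidableEq d]

/-! ### Fencing for three coupled levels -/

/-- **Fencing for three coupled energy levels** (the real-variable core of the `V → H³` estimate).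
On `[a, b]` let `E, G, Y, Z ≥ 0` with `(½G)' = G'`, `(½Y)' = Y'`, `(½Z)' = Z'` (one-sided, within
`[a, b]`), `G' ≤ −(ν/2)Y + ν⁻¹(DG + Λ₂E)`, `Y' ≤ −(ν/2)Z + K₁(G + Y)`, `Z' ≤ K₂(G + Y + Z)` and
`E + G ≤ R`. If `κ₁(ν/2) = 1 + (b − a)K₂` and `κ₂(ν/2) = (b − a)²K₂ + κ₁/2 + κ₁(b − a)K₁`, then with
`β = (b − a)²K₂ + κ₁(b − a)K₁ + κ₂ν⁻¹(D + Λ₂)`,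
`(b − a)² Z(b) ≤ κ₂ G(a) + 2βR(b − a)`: the doubly weighted combination
`Φ(s) = (s − a)²·½Z + κ₁(s − a)·½Y + κ₂·½G` has `Φ' ≤ β(E + G) ≤ βR` (the `Z`- and `Y`-terms produced
by the weights are absorbed by the retained dissipations `−(ν/2)Z`, `−(ν/2)Y`), and the fencing lemma
`image_le_of_deriv_right_le_deriv_boundary` gives `(b − a)²·½Z(b) ≤ Φ(b) ≤ κ₂·½G(a) + βR(b − a)`.
[folklore] -/
theorem Torus.sq_mul_le_of_three_level_balance {a b ν K₁ K₂ D Λ₂ R κ₁ κ₂ β : ℝ} (hab : a ≤ b)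
    (hν : 0 < ν) (hK₁ : 0 ≤ K₁) (hK₂ : 0 ≤ K₂) (hκ₁ : 0 ≤ κ₁) (hκ₂ : 0 ≤ κ₂) (hD : 0 ≤ D) (hΛ₂ : 0 ≤ Λ₂)
    (hc₁ : 1 + (b - a) * K₂ - κ₁ * (ν / 2) = 0)
    (hc₂ : (b - a) ^ 2 * K₂ + κ₁ / 2 + κ₁ * (b - a) * K₁ - κ₂ * (ν / 2) = 0)
    (hβ : β = (b - a) ^ 2 * K₂ + κ₁ * (b - a) * K₁ + κ₂ * ν⁻¹ * (D + Λ₂))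
    {E G Y Z G' Y' Z' : ℝ → ℝ} (hE : ∀ s, 0 ≤ E s) (hG : ∀ s, 0 ≤ G s) (hY : ∀ s, 0 ≤ Y s)
    (hZ : ∀ s, 0 ≤ Z s)
    (hdG : ∀ s ∈ Icc a b, HasDerivWithinAt (fun r => 2⁻¹ * G r) (G' s) (Icc a b) s)
    (hdY : ∀ s ∈ Icc a b, HasDerivWithinAt (fun r => 2⁻¹ * Y r) (Y' s) (Icc a b) s)
    (hdZ : ∀ s ∈ Icc a b, HasDerivWithinAt (fun r => 2⁻¹ * Z r) (Z' s) (Icc a b) s)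
    (hG' : ∀ s ∈ Icc a b, G' s ≤ -(ν / 2) * Y s + ν⁻¹ * (D * G s + Λ₂ * E s))
    (hY' : ∀ s ∈ Icc a b, Y' s ≤ -(ν / 2) * Z s + K₁ * (G s + Y s))
    (hZ' : ∀ s ∈ Icc a b, Z' s ≤ K₂ * (G s + Y s + Z s)) (hR : ∀ s ∈ Icc a b, E s + G s ≤ R) :
    (b - a) ^ 2 * Z b ≤ κ₂ * G a + 2 * β * R * (b - a) := by
  have hT0 : 0 ≤ b - a := sub_nonneg.2 hab
  have hR0 : 0 ≤ R := (add_nonneg (hE a) (hG a)).trans (hR a (left_mem_Icc.2 hab))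
  have hβ0 : 0 ≤ β := by rw [hβ]; positivity
  -- the doubly weighted combination and its derivative
  set Φ : ℝ → ℝ := fun s => (s - a) * ((s - a) * (2⁻¹ * Z s)) + κ₁ * ((s - a) * (2⁻¹ * Y s)) +
    κ₂ * (2⁻¹ * G s) with hΦ
  set Φ' : ℝ → ℝ := fun s => (1 * ((s - a) * (2⁻¹ * Z s)) + (s - a) * (1 * (2⁻¹ * Z s) + (s - a) * Z' s)) +
    κ₁ * (1 * (2⁻¹ * Y s) + (s - a) * Y' s) + κ₂ * G' s with hΦ'
  have hdΦ : ∀ s ∈ Icc a b, HasDerivWithinAt Φ (Φ' s) (Icc a b) s := by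
    intro s hs
    have h1 : HasDerivWithinAt (fun r => r - a) 1 (Icc a b) s := by
      have h := (hasDerivWithinAt_id s (Icc a b)).sub (hasDerivWithinAt_const s (Icc a b) a)
      rw [sub_zero] at h
      exact h
    exact ((h1.mul (h1.mul (hdZ s hs))).add ((h1.mul (hdY s hs)).const_mul κ₁)).add
      ((hdG s hs).const_mul κ₂)
  have hΦ'le : ∀ s ∈ Icc a b, Φ' s ≤ β * R := by
    intro s hs
    have hs1 : 0 ≤ s - a := by linarith [hs.1]
    have hs2 : s - a ≤ b - a := by linarith [hs.2]
    have hGs := hG s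
    have hEs := hE s
    have hYs := hY s
    have hZs := hZ s
    -- `(s - a)² Z' ≤ (s - a)² K₂ (G + Y + Z) ≤ (s - a)(b - a) K₂ Z + (b - a)² K₂ (G + Y)`
    have h4 : (s - a) ^ 2 * Z' s ≤ (s - a) ^ 2 * (K₂ * (G s + Y s + Z s)) :=
      mul_le_mul_of_nonneg_left (hZ' s hs) (sq_nonneg _)
    have h4a : (s - a) ^ 2 * (K₂ * Z s) ≤ (s - a) * (b - a) * (K₂ * Z s) := by
      rw [sq, mul_assoc, mul_assoc]
      exact mul_le_mul_of_nonneg_left (mul_le_mul_of_nonneg_right hs2 (by positivity)) hs1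
    have h4b : (s - a) ^ 2 * (K₂ * (G s + Y s)) ≤ (b - a) ^ 2 * (K₂ * (G s + Y s)) :=
      mul_le_mul_of_nonneg_right (pow_le_pow_left₀ hs1 hs2 2) (by positivity)
    -- `κ₁ (s - a) Y' ≤ κ₁ (s - a) (-(ν/2) Z + K₁ (G + Y))`, `κ₁ (s - a) K₁ (G + Y) ≤ κ₁ (b - a) K₁ (G + Y)`
    have h5 : κ₁ * (s - a) * Y' s ≤ κ₁ * (s - a) * (-(ν / 2) * Z s + K₁ * (G s + Y s)) :=
      mul_le_mul_of_nonneg_left (hY' s hs) (by positivity)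
    have h5a : κ₁ * (s - a) * (K₁ * (G s + Y s)) ≤ κ₁ * (b - a) * (K₁ * (G s + Y s)) :=
      mul_le_mul_of_nonneg_right (mul_le_mul_of_nonneg_left hs2 hκ₁) (by positivity)
    have h6 : κ₂ * G' s ≤ κ₂ * (-(ν / 2) * Y s + ν⁻¹ * (D * G s + Λ₂ * E s)) :=
      mul_le_mul_of_nonneg_left (hG' s hs) hκ₂
    have h8 : ((b - a) ^ 2 * K₂ + κ₁ * (b - a) * K₁ + κ₂ * ν⁻¹ * D) * G s + κ₂ * ν⁻¹ * Λ₂ * E s ≤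
        β * (E s + G s) := by
      rw [hβ]
      have h9 : 0 ≤ (b - a) ^ 2 * K₂ * E s := by positivity
      have h10 : 0 ≤ κ₁ * (b - a) * K₁ * E s := by positivity
      have h11 : 0 ≤ κ₂ * ν⁻¹ * D * E s := by positivity
      have h12 : 0 ≤ κ₂ * ν⁻¹ * Λ₂ * G s := by positivity
      linarith [h9, h10, h11, h12]
    calc Φ' s = (s - a) * Z s + (s - a) ^ 2 * Z' s + κ₁ * (2⁻¹ * Y s) + κ₁ * (s - a) * Y' s + κ₂ * G' s := by
          simp only [hΦ']; ring
      _ ≤ (s - a) * Z s + ((s - a) * (b - a) * (K₂ * Z s) + (b - a) ^ 2 * (K₂ * (G s + Y s))) +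
          κ₁ * (2⁻¹ * Y s) + (κ₁ * (s - a) * (-(ν / 2) * Z s) + κ₁ * (b - a) * (K₁ * (G s + Y s))) +
          κ₂ * (-(ν / 2) * Y s + ν⁻¹ * (D * G s + Λ₂ * E s)) := by linarith [h4, h4a, h4b, h5, h5a, h6]
      _ = (s - a) * (1 + (b - a) * K₂ - κ₁ * (ν / 2)) * Z s +
          ((b - a) ^ 2 * K₂ + κ₁ / 2 + κ₁ * (b - a) * K₁ - κ₂ * (ν / 2)) * Y s +
          (((b - a) ^ 2 * K₂ + κ₁ * (b - a) * K₁ + κ₂ * ν⁻¹ * D) * G s + κ₂ * ν⁻¹ * Λ₂ * E s) := by ring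
      _ = ((b - a) ^ 2 * K₂ + κ₁ * (b - a) * K₁ + κ₂ * ν⁻¹ * D) * G s + κ₂ * ν⁻¹ * Λ₂ * E s := by
          rw [hc₁, hc₂]; ring
      _ ≤ β * (E s + G s) := h8
      _ ≤ β * R := mul_le_mul_of_nonneg_left (hR s hs) hβ0
  -- fencing on `[a, b]`
  have hΦc : ContinuousOn Φ (Icc a b) := fun s hs => (hdΦ s hs).continuousWithinAt
  have hΦr : ∀ s ∈ Ico a b, HasDerivWithinAt Φ (Φ' s) (Ici s) s := fun s hs =>
    ((hdΦ s (Ico_subset_Icc_self hs)).mono (Icc_subset_Icc hs.1 le_rfl)).mono_of_mem_nhdsWithin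
      (Icc_mem_nhdsGE hs.2)
  have hfence := image_le_of_deriv_right_le_deriv_boundary hΦc hΦr
    (B := fun s => Φ a + β * R * (s - a)) (B' := fun _ => β * R) (by simp) (by fun_prop)
    (fun s _ => by
      have h1 : HasDerivWithinAt (fun r => Φ a + β * R * (r - a)) (0 + β * R * (1 - 0)) (Ici s) s :=
        (hasDerivWithinAt_const _ _ _).add (((hasDerivWithinAt_id _ _).sub
          (hasDerivWithinAt_const _ _ _)).const_mul (β * R))
      simpa using h1)
    (fun s hs => hΦ'le s (Ico_subset_Icc_self hs)) (right_mem_Icc.2 hab)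
  have hfence' : Φ b ≤ Φ a + β * R * (b - a) := hfence
  -- unwind
  have hΦa : Φ a = κ₂ * (2⁻¹ * G a) := by
    simp only [hΦ, sub_self, zero_mul, mul_zero, zero_add]
  have hlow : (b - a) * ((b - a) * (2⁻¹ * Z b)) ≤ Φ b := by
    have h1 : 0 ≤ κ₁ * ((b - a) * (2⁻¹ * Y b)) := by have := hY b; positivity
    have h2 : 0 ≤ κ₂ * (2⁻¹ * G b) := by have := hG b; positivity
    simp only [hΦ]
    linarith
  have hmain : (b - a) * ((b - a) * (2⁻¹ * Z b)) ≤ κ₂ * (2⁻¹ * G a) + β * R * (b - a) := by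
    linarith [hlow, hfence', hΦa]
  linarith [hmain]

/-! ### The smoothing estimate -/

/-- **`V → H³` smoothing of the linearised Navier–Stokes equation on `T³`.** On `T^d` with
`card d = 3`, for `ν > 0`, coefficient levels `M`, `L`, `Y₁`, `Z₁` and a time lapse `τ > 0` there is
a constant `C` such that: for every jointly smooth `u` on `[a, a + τ] × T^d` with divergence-free
slices, `‖u‖ ≤ M`, `‖∂ᵢu‖ ≤ L`, `∫ ‖Δu(t)‖² ≤ Y₁` and `‖∇Δu(t)‖₂² ≤ Z₁` there, and every jointly
smooth `(w, q)` with `div w(t) = 0`, `∫ w(t) = 0` and `∂ₜw + (u·∇)w + (w·∇)u = νΔw − ∇q` pointwise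
(one-sided time derivative within `[a, a + τ]`),
`‖∇Δw(a + τ)‖₂² ≤ C (∫ ‖w(a)‖² + ‖∇w(a)‖₂²)` —
the solution operator of the first variation equation maps `V` boundedly into `D(A^{3/2})` for
`t > a` (Constantin–Foias 1988, Ch. 14, the discussion after (14.4), two Sobolev levels above the
`H → V` bound, via the a priori estimates of Prop. 13.2 and Thm 10.6), with a constant depending on
`u` only through `M`, `L`, `Y₁`, `Z₁` and on the time lapse. Proof: the `H¹`, `H²`, `H³` balances with
their flux bounds, each keeping half of its dissipation,
`(½‖∇w‖₂²)' ≤ −(ν/2)‖Δw‖₂² + ν⁻¹(dM²‖∇w‖₂² + (dL)² ∫‖w‖²)`,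
`(½‖Δw‖₂²)' ≤ −(ν/2)‖∇Δw‖₂² + K₁(‖∇w‖₂² + ‖Δw‖₂²)`,
`(½‖∇Δw‖₂²)' ≤ K₂(‖∇w‖₂² + ‖Δw‖₂² + ‖∇Δw‖₂²)`, the exponential `H¹` bound
`Torus.linearisedNS_h1_le_mul_exp`, and the three-level fencing lemma
`Torus.sq_mul_le_of_three_level_balance` for the doubly weighted combination
`(s − a)²·½‖∇Δw‖₂² + κ₁(s − a)·½‖Δw‖₂² + κ₂·½‖∇w‖₂²`, `κ₁ = 2(1 + τK₂)/ν`,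
`κ₂ = 2(τ²K₂ + κ₁/2 + κ₁τK₁)/ν`.
[cite: ConstantinFoiasNSE1988, Ch. 14 (14.2)–(14.4) with Prop. 13.2 and Thm 10.6] -/
theorem Torus.linearisedNS_gradNormSq_laplacian_le_mul (hd : Fintype.card d = 3)
    {ν : ℝ} (hν : 0 < ν) (M L Y₁ Z₁ : ℝ) {τ : ℝ} (hτ : 0 < τ) :
    ∃ C : ℝ, ∀ {a : ℝ} {u w : ℝ → UnitAddTorus d → EuclideanSpace ℝ d} {q : ℝ → UnitAddTorus d → ℝ},
      Torus.IsSmoothSpaceTimeOn (Icc a (a + τ)) u → (∀ t ∈ Icc a (a + τ), Torus.IsDivFree (u t)) →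
      (∀ t ∈ Icc a (a + τ), ∀ x, ‖u t x‖ ≤ M) →
      (∀ i, ∀ t ∈ Icc a (a + τ), ∀ x, ‖Torus.partialDeriv i (u t) x‖ ≤ L) →
      (∀ t ∈ Icc a (a + τ), ∫ x, ‖Torus.laplacian (u t) x‖ ^ 2 ≤ Y₁) →
      (∀ t ∈ Icc a (a + τ), Torus.gradNormSq (Torus.laplacian (u t)) ≤ Z₁) →
      Torus.IsSmoothSpaceTimeOn (Icc a (a + τ)) w → Torus.IsSmoothSpaceTimeOn (Icc a (a + τ)) q →
      (∀ t ∈ Icc a (a + τ), Torus.IsDivFree (w t)) →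
      (∀ t ∈ Icc a (a + τ), Torus.HasZeroMean (w t)) →
      (∀ t ∈ Icc a (a + τ), ∀ x, Torus.timeDerivWithin (Icc a (a + τ)) w t x +
        Torus.convect (u t) (w t) x + Torus.convect (w t) (u t) x =
          ν • Torus.laplacian (w t) x - Torus.gradient (q t) x) →
      Torus.gradNormSq (Torus.laplacian (w (a + τ))) ≤
        C * ((∫ x, ‖w a x‖ ^ 2) + Torus.gradNormSq (w a)) := by
  obtain ⟨K, hK, hflux⟩ := Torus.linearisedNS_laplacian_flux_le (d := d) hd
  obtain ⟨C₃, hC₃0, hflux₃⟩ := Torus.linearisedNS_gradNormSq_laplacian_flux_le (d := d) hd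
  have hν0 : ν ≠ 0 := hν.ne'
  have hd0 : (0 : ℝ) ≤ Fintype.card d := Nat.cast_nonneg _
  -- the constants (all depend on `d, ν, M, L, Y₁, Z₁, τ` only; kept opaque with defining equations)
  set Y₁' : ℝ := max Y₁ 0 with hY₁'
  have hY₁'0 : 0 ≤ Y₁' := le_max_right _ _
  set Z₁' : ℝ := max Z₁ 0 with hZ₁'
  have hZ₁'0 : 0 ≤ Z₁' := le_max_right _ _
  obtain ⟨K₁, hK₁⟩ : ∃ K₁ : ℝ, K₁ = 2 * ν⁻¹ * (2 * Fintype.card d * M ^ 2 + 4 * Fintype.card d ^ 2 * L ^ 2 +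
    2 * Fintype.card d * K * Y₁') := ⟨_, rfl⟩
  have hK₁0 : 0 ≤ K₁ := by rw [hK₁]; positivity
  obtain ⟨K₂, hK₂⟩ : ∃ K₂ : ℝ, K₂ = ν⁻¹ * (C₃ * (M ^ 2 + L ^ 2 + Y₁' + Z₁')) := ⟨_, rfl⟩
  have hK₂0 : 0 ≤ K₂ := by rw [hK₂]; positivity
  obtain ⟨κ₁, hκ₁⟩ : ∃ κ₁ : ℝ, κ₁ = 2 * (1 + τ * K₂) / ν := ⟨_, rfl⟩
  have hκ₁0 : 0 ≤ κ₁ := by rw [hκ₁]; positivity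
  obtain ⟨κ₂, hκ₂⟩ : ∃ κ₂ : ℝ, κ₂ = 2 * (τ ^ 2 * K₂ + κ₁ / 2 + κ₁ * τ * K₁) / ν := ⟨_, rfl⟩
  have hκ₂0 : 0 ≤ κ₂ := by rw [hκ₂]; positivity
  obtain ⟨D, hD⟩ : ∃ D : ℝ, D = Fintype.card d * M ^ 2 := ⟨_, rfl⟩
  have hD0 : 0 ≤ D := by rw [hD]; positivity
  obtain ⟨Λ, hΛ⟩ : ∃ Λ : ℝ, Λ = Fintype.card d * L := ⟨_, rfl⟩
  obtain ⟨β, hβ⟩ : ∃ β : ℝ, β = τ ^ 2 * K₂ + κ₁ * τ * K₁ + κ₂ * ν⁻¹ * (D + Λ ^ 2) := ⟨_, rfl⟩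
  have hβ0 : 0 ≤ β := by rw [hβ]; positivity
  obtain ⟨K', hK'⟩ : ∃ K' : ℝ, K' = 2 * Λ + (Λ ^ 2 + D) / ν := ⟨_, rfl⟩
  refine ⟨κ₂ / τ ^ 2 + 2 * β * Real.exp (K' * τ) / τ,
    fun {a u w q} hu hudiv hM hL hY₁ hZ₁ hw hq hwdiv hmean hlin => ?_⟩
  set b : ℝ := a + τ with hb
  have hab : a < b := by rw [hb]; linarith
  have ha : a ∈ Icc a b := left_mem_Icc.2 hab.le
  have hba : b - a = τ := by rw [hb]; ring
  obtain ⟨i₀⟩ : Nonempty d := Fintype.card_pos_iff.1 (by rw [hd]; norm_num)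
  have hL0 : 0 ≤ L := (norm_nonneg _).trans (hL i₀ a ha 0)
  have hΛ0 : 0 ≤ Λ := by rw [hΛ]; positivity
  have hK'0 : 0 ≤ K' := by rw [hK']; positivity
  have hsumL : ∑ _i : d, L = Λ := by rw [Finset.sum_const, Finset.card_univ, nsmul_eq_mul, hΛ]
  -- the four energies along the solution and the three fluxes
  set E : ℝ → ℝ := fun s => ∫ x, ‖w s x‖ ^ 2 with hE
  set G : ℝ → ℝ := fun s => Torus.gradNormSq (w s) with hG
  set Y : ℝ → ℝ := fun s => ∫ x, ‖Torus.laplacian (w s) x‖ ^ 2 with hY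
  set Z : ℝ → ℝ := fun s => Torus.gradNormSq (Torus.laplacian (w s)) with hZ
  have hE0 : ∀ s, 0 ≤ E s := fun s => integral_nonneg fun x => sq_nonneg _
  have hG0 : ∀ s, 0 ≤ G s := fun s => Torus.gradNormSq_nonneg _
  have hY0 : ∀ s, 0 ≤ Y s := fun s => integral_nonneg fun x => sq_nonneg _
  have hZ0 : ∀ s, 0 ≤ Z s := fun s => Torus.gradNormSq_nonneg _
  set G' : ℝ → ℝ := fun s => -ν * (∫ x, ‖Torus.laplacian (w s) x‖ ^ 2) +
    ∫ x, ⟪Torus.convect (u s) (w s) x + Torus.convect (w s) (u s) x, Torus.laplacian (w s) x⟫ with hG'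
  set Y' : ℝ → ℝ := fun s => -ν * Torus.gradNormSq (Torus.laplacian (w s)) -
    ∫ x, ⟪Torus.convect (u s) (w s) x + Torus.convect (w s) (u s) x,
      Torus.laplacian (Torus.laplacian (w s)) x⟫ with hY'
  set Z' : ℝ → ℝ := fun s => -ν * (∫ x, ‖Torus.laplacian (Torus.laplacian (w s)) x‖ ^ 2) +
    ∫ x, ⟪Torus.convect (u s) (w s) x + Torus.convect (w s) (u s) x,
      Torus.laplacian (Torus.laplacian (Torus.laplacian (w s))) x⟫ with hZ'
  -- the three balances
  have hdG : ∀ s ∈ Icc a b, HasDerivWithinAt (fun r => 2⁻¹ * G r) (G' s) (Icc a b) s := fun s hs =>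
    Torus.linearisedNS_hasDerivWithinAt_half_gradNormSq hu hw hq hwdiv hlin hab hs
  have hdY : ∀ s ∈ Icc a b, HasDerivWithinAt (fun r => 2⁻¹ * Y r) (Y' s) (Icc a b) s := fun s hs =>
    Torus.linearisedNS_hasDerivWithinAt_half_integral_norm_laplacian_sq hu hw hq hwdiv hlin hab hs
  have hdZ : ∀ s ∈ Icc a b, HasDerivWithinAt (fun r => 2⁻¹ * Z r) (Z' s) (Icc a b) s := fun s hs =>
    Torus.linearisedNS_hasDerivWithinAt_half_gradNormSq_laplacian hu hw hq hwdiv hlin hab hs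
  -- the flux bounds: `G' ≤ -(ν/2) Y + ν⁻¹ (D G + Λ² E)`, `Y' ≤ -(ν/2) Z + K₁ (G + Y)`,
  -- `Z' ≤ K₂ (G + Y + Z)`
  have hG'le : ∀ s ∈ Icc a b, G' s ≤ -(ν / 2) * Y s + ν⁻¹ * (D * G s + Λ ^ 2 * E s) := by
    intro s hs
    have h := Torus.linearisedNS_half_gradNormSq_flux_le (half_pos hν) (hu.isSmooth_slice hs)
      (hw.isSmooth_slice hs) (hM s hs) (C := fun _ => L) fun i x => hL i s hs x
    simp only [hsumL] at h
    have h2 : (2 * (ν / 2))⁻¹ = ν⁻¹ := by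
      congr 1; ring
    rw [h2, ← hD] at h
    have hYs := hY0 s
    simp only [hG']
    linarith
  have hY'le : ∀ s ∈ Icc a b, Y' s ≤ -(ν / 2) * Z s + K₁ * (G s + Y s) := by
    intro s hs
    have h := hflux (half_pos hν) (hu.isSmooth_slice hs) (hw.isSmooth_slice hs) (hmean s hs) (hM s hs)
      fun k x => hL k s hs x
    have h2 : (ν / 2)⁻¹ = 2 * ν⁻¹ := by
      rw [inv_div, div_eq_mul_inv]
    rw [h2] at h
    have hGs := hG0 s
    have hYs := hY0 s
    have hYu0 : 0 ≤ ∫ x, ‖Torus.laplacian (u s) x‖ ^ 2 := integral_nonneg fun x => sq_nonneg _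
    have h1 : 2 * Fintype.card d * K * (G s + Y s) * (∫ x, ‖Torus.laplacian (u s) x‖ ^ 2) ≤
        2 * Fintype.card d * K * (G s + Y s) * Y₁' :=
      mul_le_mul_of_nonneg_left ((hY₁ s hs).trans (le_max_left _ _)) (by positivity)
    have h3 : 0 ≤ 2 * Fintype.card d * M ^ 2 * G s := by positivity
    have h4 : 0 ≤ 4 * Fintype.card d ^ 2 * L ^ 2 * Y s := by positivity
    have h5 : 2 * Fintype.card d * M ^ 2 * Y s + 4 * Fintype.card d ^ 2 * L ^ 2 * G s +
        2 * Fintype.card d * K * (G s + Y s) * (∫ x, ‖Torus.laplacian (u s) x‖ ^ 2) ≤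
        (2 * Fintype.card d * M ^ 2 + 4 * Fintype.card d ^ 2 * L ^ 2 +
          2 * Fintype.card d * K * Y₁') * (G s + Y s) := by
      linarith [h1, h3, h4]
    have h6 : 2 * ν⁻¹ * (2 * Fintype.card d * M ^ 2 * Y s + 4 * Fintype.card d ^ 2 * L ^ 2 * G s +
        2 * Fintype.card d * K * (G s + Y s) * ∫ x, ‖Torus.laplacian (u s) x‖ ^ 2) ≤ K₁ * (G s + Y s) := by
      rw [hK₁, mul_assoc (2 * ν⁻¹)]
      exact mul_le_mul_of_nonneg_left h5 (by positivity)
    have h7 : Y' s = -(ν / 2) * Z s + (-(ν / 2) * Torus.gradNormSq (Torus.laplacian (w s)) -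
        ∫ x, ⟪Torus.convect (u s) (w s) x + Torus.convect (w s) (u s) x,
          Torus.laplacian (Torus.laplacian (w s)) x⟫) := by
      simp only [hY', hZ]; ring
    rw [h7]
    linarith [h, h6]
  have hZ'le : ∀ s ∈ Icc a b, Z' s ≤ K₂ * (G s + Y s + Z s) := by
    intro s hs
    have h := hflux₃ hν (hu.isSmooth_slice hs) (hw.isSmooth_slice hs) (hmean s hs) (hM s hs)
      fun k x => hL k s hs x
    have hGs := hG0 s
    have hYs := hY0 s
    have hZs := hZ0 s
    have hW0 : 0 ≤ ν / 2 * ∫ x, ‖Torus.laplacian (Torus.laplacian (w s)) x‖ ^ 2 :=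
      mul_nonneg (by positivity) (integral_nonneg fun x => sq_nonneg _)
    have hYu : ∫ x, ‖Torus.laplacian (u s) x‖ ^ 2 ≤ Y₁' := (hY₁ s hs).trans (le_max_left _ _)
    have hZu : Torus.gradNormSq (Torus.laplacian (u s)) ≤ Z₁' := (hZ₁ s hs).trans (le_max_left _ _)
    have h1 : C₃ * (M ^ 2 + L ^ 2 + (∫ x, ‖Torus.laplacian (u s) x‖ ^ 2) +
        Torus.gradNormSq (Torus.laplacian (u s))) * (G s + Y s + Z s) ≤
        C₃ * (M ^ 2 + L ^ 2 + Y₁' + Z₁') * (G s + Y s + Z s) :=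
      mul_le_mul_of_nonneg_right (mul_le_mul_of_nonneg_left (by linarith) hC₃0) (by positivity)
    have h2 : ν⁻¹ * (C₃ * (M ^ 2 + L ^ 2 + (∫ x, ‖Torus.laplacian (u s) x‖ ^ 2) +
        Torus.gradNormSq (Torus.laplacian (u s))) * (G s + Y s + Z s)) ≤ K₂ * (G s + Y s + Z s) := by
      rw [hK₂, mul_assoc ν⁻¹]
      exact mul_le_mul_of_nonneg_left h1 (inv_pos.2 hν).le
    simp only [hZ']
    linarith [h, h2, hW0]
  -- the exponential `H¹` bound: `E + G ≤ (E a + G a) e^{K' τ}` on `[a, b]`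
  have hH : ∀ s ∈ Icc a b, E s + G s ≤ (E a + G a) * Real.exp (K' * τ) := by
    intro s hs
    have h := Torus.linearisedNS_h1_le_mul_exp hν hu hudiv hw hq hwdiv hlin hM (C := fun _ => L) hL hs
    simp only [hsumL] at h
    refine h.trans (mul_le_mul_of_nonneg_left (Real.exp_le_exp.2 ?_) (add_nonneg (hE0 a) (hG0 a)))
    have h1 : s - a ≤ τ := by rw [hb] at hs; linarith [hs.2]
    have h3 : 2 * Λ + (Λ ^ 2 + Fintype.card d * M ^ 2) / ν = K' := by rw [hK', hD]
    rw [h3]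
    exact mul_le_mul_of_nonneg_left h1 hK'0
  -- the three-level fencing lemma on `[a, b]`
  have hc₁ : 1 + (b - a) * K₂ - κ₁ * (ν / 2) = 0 := by
    rw [hba, hκ₁]; field_simp; ring
  have hc₂ : (b - a) ^ 2 * K₂ + κ₁ / 2 + κ₁ * (b - a) * K₁ - κ₂ * (ν / 2) = 0 := by
    rw [hba, hκ₂]; field_simp; ring
  have hβ' : β = (b - a) ^ 2 * K₂ + κ₁ * (b - a) * K₁ + κ₂ * ν⁻¹ * (D + Λ ^ 2) := by rw [hba, hβ]
  have key := Torus.sq_mul_le_of_three_level_balance hab.le hν hK₁0 hK₂0 hκ₁0 hκ₂0 hD0 (sq_nonneg Λ)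
    hc₁ hc₂ hβ' hE0 hG0 hY0 hZ0 hdG hdY hdZ hG'le hY'le hZ'le hH
  -- unwind
  rw [hba] at key
  set H₀ : ℝ := E a + G a with hH₀
  have hGa : G a ≤ H₀ := le_add_of_nonneg_left (hE0 a)
  have hκG : κ₂ * G a ≤ κ₂ * H₀ := mul_le_mul_of_nonneg_left hGa hκ₂0
  have hmain : τ ^ 2 * Z b ≤ κ₂ * H₀ + 2 * β * Real.exp (K' * τ) * τ * H₀ := by linarith [key, hκG]
  have hτ0 : τ ≠ 0 := hτ.ne'
  calc Z b = (τ ^ 2)⁻¹ * (τ ^ 2 * Z b) := by field_simp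
    _ ≤ (τ ^ 2)⁻¹ * (κ₂ * H₀ + 2 * β * Real.exp (K' * τ) * τ * H₀) :=
        mul_le_mul_of_nonneg_left hmain (by positivity)
    _ = (κ₂ / τ ^ 2 + 2 * β * Real.exp (K' * τ) / τ) * H₀ := by
        field_simp

end Literature.Analysis.FluidPDE

end
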